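import Literature.AlgebraicGeometry.HodgeTheory.DegreeOneHodgeTypes
import Mathlib.Analysis.Matrix.PosDef
import HarnessLib

/-!
# Ring 2 · AbelianAll (ab-weil-1, gen 7, part 2/4) — the determinant of a Hermitian matrix definite of
  opposite signs on complementary subspaces

research route, not a corollary; conditional on HC_CM plus one named minimal statement.
Cell line: research route conditional on HC_CM; not a corollary; Q11.4-sentence-2 already refuted in dim ≥ 3.
`HC_CM` (`Theses.RankFourFaces.CMAbelianHodge`) does not occur in this file, and no open case of the
Hodge conjecture is claimed. This part is linear algebra only (Sylvester's law in determinant form), used in part 3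
(`Ring2AbelianAllWeilSignature`) for van Geemen's Lemma 5.2 (4).

## What is proved (0 sorry)

* §2 `det_eq_neg_one_pow_mul_of_definite` — a Hermitian matrix `G ∈ M_k(ℂ)` whose form
  `x̄ᵗ G y` is positive definite on a subspace `P`, negative definite on a complement `N` and for which
  `P ⊥ N`, has `det G = (-1)^{dim N} · r` with `r > 0`. Proof: with the reflection `Σ = id_P ⊕ (-id_N)`
  (`det Σ = (-1)^{dim N}`) the matrix `G·Σ` is positive definite (`Matrix.PosDef.det_pos`).
* §2b small helpers for part 3: `hodgeOneZero_congr` / `hodgeZeroOne_congr` (the carriers `H^{1,0}`,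
  `H^{0,1}` do not depend on the spelling of the dimension index), `conjClass_sum_smul`,
  `star_dotProduct_gram_mulVec` (the form of a Gram-type matrix on coordinate vectors),
  `linearIndependent_map_add_smul`.

No Literature fact is introduced.

## References

* [vanGeemen1994HodgeAV] B. van Geemen, An introduction to the Hodge conjecture for abelian varieties,
  LNM 1594 (1994), Lemma 5.2 (4).
* [VoisinHodgeI2002] C. Voisin, Hodge Theory and Complex Algebraic Geometry I, Thm. 6.32.
-/

noncomputable section

set_option linter.dupNamespace false

open Literature.AlgebraicGeometry Literature.AlgebraicGeometry.Motives
open Literature.AlgebraicGeometry.HodgeTheory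
open Literature.AlgebraicTopology.SingularHomology

namespace Summit.HodgeConjecture.HodgeConjecture.Ring2.AbelianAll

/-! ### §2 The determinant of a Hermitian matrix definite of opposite signs on complementary subspaces -/

section MatrixSign

open scoped ComplexOrder
open Matrix

variable {k : ℕ}

/-- The sesquilinear form `⟨x, y⟩_G = x^* G y` of a matrix: additivity and negation in each slot,
Hermitian symmetry. [folklore] -/
private theorem form_add_left (G : Matrix (Fin k) (Fin k) ℂ) (x x' y : Fin k → ℂ) :
    star (x + x') ⬝ᵥ G *ᵥ y = star x ⬝ᵥ G *ᵥ y + star x' ⬝ᵥ G *ᵥ y := by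
  rw [star_add, add_dotProduct]

/-- Additivity of `x^* G y` in `y`. [folklore] -/
private theorem form_add_right (G : Matrix (Fin k) (Fin k) ℂ) (x y y' : Fin k → ℂ) :
    star x ⬝ᵥ G *ᵥ (y + y') = star x ⬝ᵥ G *ᵥ y + star x ⬝ᵥ G *ᵥ y' := by
  rw [mulVec_add, dotProduct_add]

/-- `(-x)^* G y = -(x^* G y)`. [folklore] -/
private theorem form_neg_left (G : Matrix (Fin k) (Fin k) ℂ) (x y : Fin k → ℂ) :
    star (-x) ⬝ᵥ G *ᵥ y = -(star x ⬝ᵥ G *ᵥ y) := by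
  rw [star_neg, neg_dotProduct]

/-- `x^* G (-y) = -(x^* G y)`. [folklore] -/
private theorem form_neg_right (G : Matrix (Fin k) (Fin k) ℂ) (x y : Fin k → ℂ) :
    star x ⬝ᵥ G *ᵥ (-y) = -(star x ⬝ᵥ G *ᵥ y) := by
  rw [mulVec_neg, dotProduct_neg]

/-- Hermitian symmetry `conj (x^* G y) = y^* G x`. [folklore] -/
private theorem form_star {G : Matrix (Fin k) (Fin k) ℂ} (hG : G.IsHermitian) (x y : Fin k → ℂ) :
    star (star x ⬝ᵥ G *ᵥ y) = star y ⬝ᵥ G *ᵥ x := by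
  rw [star_dotProduct, star_star, star_mulVec, hG.eq, ← dotProduct_mulVec]

/-- `0^* G y = 0`. [folklore] -/
private theorem form_zero_left (G : Matrix (Fin k) (Fin k) ℂ) (y : Fin k → ℂ) :
    star (0 : Fin k → ℂ) ⬝ᵥ G *ᵥ y = 0 := by
  rw [star_zero, zero_dotProduct]

/-- The `(i, j)` entry of `M` as a value of the form on the standard basis. [folklore] -/
private theorem form_single_single (M : Matrix (Fin k) (Fin k) ℂ) (i j : Fin k) :
    star (Pi.single i (1 : ℂ)) ⬝ᵥ M *ᵥ Pi.single j 1 = M i j := by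
  rw [← Pi.single_star, star_one, mulVec_single_one, single_one_dotProduct]
  rfl

/-- **Reflection trick.** Let `G` be a Hermitian `k × k` complex matrix and `P ⊕ N = ℂᵏ` a splitting with
`P ⊥_G N`, `x^* G x > 0` on `P ∖ 0` and `< 0` on `N ∖ 0`. Then `det G = (-1)^{dim N} · r` with `r > 0`:
for the reflection `Σ = id_P ⊕ (-id_N)` the matrix `G Σ` is Hermitian positive definite, so
`det G · (-1)^{dim N} = det (G Σ) > 0`. (Sylvester's law of inertia, determinant form.) [folklore] -/
theorem det_eq_neg_one_pow_mul_of_definite {G : Matrix (Fin k) (Fin k) ℂ} (hG : G.IsHermitian)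
    {P N : Submodule ℂ (Fin k → ℂ)} (hPN : IsCompl P N)
    (horth : ∀ p ∈ P, ∀ q ∈ N, star p ⬝ᵥ G *ᵥ q = 0)
    (hpos : ∀ p ∈ P, p ≠ 0 → 0 < star p ⬝ᵥ G *ᵥ p)
    (hneg : ∀ q ∈ N, q ≠ 0 → star q ⬝ᵥ G *ᵥ q < 0) :
    ∃ r : ℝ, 0 < r ∧ G.det = (-1) ^ Module.finrank ℂ N * r := by
  classical
  -- the reflection `Σ (p + q) = p - q`
  set S : Module.End ℂ (Fin k → ℂ) :=
    ((P.prodEquivOfIsCompl N hPN : (P × N) ≃ₗ[ℂ] (Fin k → ℂ)) : (P × N) →ₗ[ℂ] (Fin k → ℂ)) ∘ₗ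
      LinearMap.prodMap LinearMap.id (-LinearMap.id) ∘ₗ
      ((P.prodEquivOfIsCompl N hPN).symm : (Fin k → ℂ) →ₗ[ℂ] (P × N)) with hS
  have hSapply : ∀ p ∈ P, ∀ q ∈ N, S (p + q) = p - q := by
    intro p hp q hq
    have h1 : (P.prodEquivOfIsCompl N hPN).symm p = (⟨p, hp⟩, 0) :=
      Submodule.prodEquivOfIsCompl_symm_apply_left P N hPN ⟨p, hp⟩
    have h2 : (P.prodEquivOfIsCompl N hPN).symm q = (0, ⟨q, hq⟩) :=
      Submodule.prodEquivOfIsCompl_symm_apply_right P N hPN ⟨q, hq⟩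
    simp only [hS, LinearMap.coe_comp, LinearEquiv.coe_coe, Function.comp_apply, map_add, h1, h2,
      LinearMap.prodMap_apply, LinearMap.id_apply, LinearMap.neg_apply, neg_zero,
      Submodule.coe_prodEquivOfIsCompl', Submodule.coe_zero, add_zero, zero_add, Submodule.coe_neg]
    abel
  have hdetS : LinearMap.det S = (-1) ^ Module.finrank ℂ N := by
    rw [hS, LinearMap.det_conj, LinearMap.det_prodMap, LinearMap.det_id, one_mul,
      show (-LinearMap.id : Module.End ℂ N) = (-1 : ℂ) • LinearMap.id from
        (neg_one_smul ℂ (LinearMap.id : Module.End ℂ N)).symm,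
      LinearMap.det_smul, LinearMap.det_id, mul_one]
  -- every vector splits
  have hsplit : ∀ v : Fin k → ℂ, ∃ p ∈ P, ∃ q ∈ N, p + q = v := fun v =>
    Submodule.mem_sup.1 (by rw [hPN.sup_eq_top]; exact Submodule.mem_top)
  have horth' : ∀ q ∈ N, ∀ p ∈ P, star q ⬝ᵥ G *ᵥ p = 0 := fun q hq p hp => by
    rw [← form_star hG, horth p hp q hq, star_zero]
  -- `⟨S v, w⟩ = ⟨v, S w⟩ = ⟨p, p'⟩ - ⟨q, q'⟩`
  have hkey : ∀ v w : Fin k → ℂ, star (S v) ⬝ᵥ G *ᵥ w = star v ⬝ᵥ G *ᵥ (S w) := by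
    intro v w
    obtain ⟨p, hp, q, hq, rfl⟩ := hsplit v
    obtain ⟨p', hp', q', hq', rfl⟩ := hsplit w
    rw [hSapply p hp q hq, hSapply p' hp' q' hq', sub_eq_add_neg, sub_eq_add_neg]
    simp only [form_add_left, form_add_right, form_neg_left, form_neg_right, horth p hp q' hq',
      horth' q hq p' hp', neg_zero, add_zero, zero_add]
  -- the matrix `G * Σ` is Hermitian positive definite
  set Sm : Matrix (Fin k) (Fin k) ℂ := LinearMap.toMatrix' S with hSm
  have hSmv : ∀ v, Sm *ᵥ v = S v := fun v => LinearMap.toMatrix'_mulVec S v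
  have hGS : ∀ x y : Fin k → ℂ, star x ⬝ᵥ (G * Sm) *ᵥ y = star x ⬝ᵥ G *ᵥ (S y) := fun x y => by
    rw [← mulVec_mulVec, hSmv]
  have hPD : (G * Sm).PosDef := by
    refine Matrix.posDef_iff_dotProduct_mulVec.2 ⟨?_, fun x hx => ?_⟩
    · refine Matrix.IsHermitian.ext fun i j => ?_
      rw [← form_single_single (G * Sm) j i, ← form_single_single (G * Sm) i j, hGS, hGS, ← hkey,
        form_star hG]
    · obtain ⟨p, hp, q, hq, rfl⟩ := hsplit x
      rw [hGS, hSapply p hp q hq, sub_eq_add_neg]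
      simp only [form_add_left, form_add_right, form_neg_right, horth p hp q hq, horth' q hq p hp,
        add_zero, zero_add]
      by_cases hp0 : p = 0
      · have hq0 : q ≠ 0 := by rintro rfl; exact hx (by rw [hp0, add_zero])
        rw [hp0, form_zero_left, zero_add, neg_pos]
        exact hneg q hq hq0
      · by_cases hq0 : q = 0
        · rw [hq0, mulVec_zero, dotProduct_zero, neg_zero, add_zero]
          exact hpos p hp hp0
        · exact add_pos (hpos p hp hp0) (neg_pos.2 (hneg q hq hq0))
  have hdet := hPD.det_pos
  rw [det_mul, hSm, LinearMap.det_toMatrix', hdetS] at hdet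
  obtain ⟨hre, him⟩ := Complex.lt_def.1 hdet
  rw [Complex.zero_re] at hre
  rw [Complex.zero_im] at him
  refine ⟨(G.det * (-1) ^ Module.finrank ℂ N).re, hre, ?_⟩
  have hreal : ((G.det * (-1) ^ Module.finrank ℂ N).re : ℂ) = G.det * (-1) ^ Module.finrank ℂ N :=
    Complex.ext (by simp) (by rw [Complex.ofReal_im]; exact him)
  rw [hreal, mul_comm, mul_assoc, ← mul_pow, neg_one_mul, neg_neg, one_pow, mul_one]

end MatrixSign

/-! ### §2b Helpers for the signature computation -/

section Helpers

open Matrix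

/-- `H^{1,0}` does not depend on the spelling of the dimension index. [folklore] -/
theorem hodgeOneZero_congr {X : SchemeOver ℂ} {k k' : ℕ} (h : k = k') (hk : IsSmoothProjective k X)
    (hk' : IsSmoothProjective k' X) : hodgeOneZero hk = hodgeOneZero hk' := by
  subst h; rfl

/-- `H^{0,1}` does not depend on the spelling of the dimension index. [folklore] -/
theorem hodgeZeroOne_congr {X : SchemeOver ℂ} {k k' : ℕ} (h : k = k') (hk : IsSmoothProjective k X)
    (hk' : IsSmoothProjective k' X) : hodgeZeroOne hk = hodgeZeroOne hk' := by
  subst h; rfl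

/-- Conjugation of a linear combination of classes. [folklore] -/
theorem conjClass_sum_smul {Y : Type} [TopologicalSpace Y] {k : ℕ} {ι : Type*} (s : Finset ι)
    (c : ι → ℂ) (v : ι → singularCohomology ℂ ℂ Y k) :
    conjClass Y k (∑ i ∈ s, c i • v i) = ∑ i ∈ s, starRingEnd ℂ (c i) • conjClass Y k (v i) := by
  rw [← conjClassEquiv_apply, map_sum]
  exact Finset.sum_congr rfl fun i _ => by rw [conjClassEquiv_apply, conjClass_smul]

/-- The sesquilinear form of a Gram-type matrix `G_ij = c · B(ū_i, u_j)` evaluated on coordinate vectors.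
[folklore] -/
theorem star_dotProduct_gram_mulVec {V : Type*} [AddCommGroup V] [Module ℂ V] {k : ℕ}
    (B : V →ₗ[ℂ] V →ₗ[ℂ] ℂ) (c : ℂ) (ub u : Fin k → V) (a b : Fin k → ℂ) :
    star a ⬝ᵥ (Matrix.of fun i j => c * B (ub i) (u j)) *ᵥ b =
      c * B (∑ i, starRingEnd ℂ (a i) • ub i) (∑ j, b j • u j) := by
  simp only [dotProduct, Matrix.mulVec, Matrix.of_apply, Pi.star_apply, Complex.star_def, map_sum, map_smul,
    LinearMap.sum_apply, LinearMap.smul_apply, smul_eq_mul, Finset.mul_sum]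
  rw [Finset.sum_comm]
  refine Finset.sum_congr rfl fun i _ => Finset.sum_congr rfl fun j _ => ?_
  ring

/-- If `{x_i, T x_i}` is linearly independent, so is `{T x_j + ε x_j}`. [folklore] -/
theorem linearIndependent_map_add_smul {V : Type*} [AddCommGroup V] [Module ℂ V] {k : ℕ} (T : V →ₗ[ℂ] V)
    (x : Fin k → V) (ε : ℂ) (hind : LinearIndependent ℂ (Sum.elim x (fun i => T (x i)))) :
    LinearIndependent ℂ (fun j => T (x j) + ε • x j) := by
  rw [Fintype.linearIndependent_iff]
  intro g hg j
  have hg' : ∑ i, Sum.elim (fun j => g j * ε) g i • Sum.elim x (fun i => T (x i)) i = 0 := by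
    rw [Fintype.sum_sum_type]
    simp only [Sum.elim_inl, Sum.elim_inr]
    rw [← hg]
    simp only [smul_add, smul_smul, Finset.sum_add_distrib]
    rw [add_comm]
  have h := (Fintype.linearIndependent_iff.1 hind) _ hg' (Sum.inr j)
  simpa using h

end Helpers

end Summit.HodgeConjecture.HodgeConjecture.Ring2.AbelianAll

end
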